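import Literature.Geometry.Lorentzian.BlackHoles
import HarnessLib

/-!
# Uniqueness of static vacuum black holes without analyticity (Chruściel–Galloway 2010)

This Literature file records the classification theorem for **static** vacuum black holes in the
form in which the hypothesis of **analyticity has been removed** (Chruściel–Galloway, *Class.
Quantum Grav.* 27 (2010) 152001 = arXiv:1004.0513; printed as the classification Theorem 3.1 of
Chruściel–Costa–Heusler, *Living Rev. Relativity* 15 (2012) 7 = arXiv:1205.6112, §3.1), on top
of the Lorentz prelude (`Stationary`, `KerrSchild`/`KerrData`) and of the stationary (Kerr)
uniqueness schema of `BlackHoles.lean` (**gr.S23**, `stationary_black_hole_uniqueness`), whose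
conventions (hypothesis structure `StationaryAFBlackHole`, conclusion by an isometry of the open
submanifold `⟨⟨M_ext⟩⟩` onto an ingoing Kerr–Schild exterior chart) it follows.

## The printed statements

* Chruściel–Costa–Heusler 2012, §3.1, definition: "A stationary spacetime is called *static* if
  the Killing vector `X` is hypersurface-orthogonal: this means that the distribution of the
  hyperplanes orthogonal to `X` is integrable. Equivalently, `X ∧ dX = 0`" (`X` also denoting
  the associated one-form).
* Chruściel–Costa–Heusler 2012, **Theorem 3.1** (static classification; summarising
  Bunting–Masood-ul-Alam, Chruściel 1999, Chruściel–Tod 2007, Chruściel–Reall–Tod 2006 and, for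
  the removal of analyticity, Chruściel–Galloway 2010): "Let `(M, g)` be an electrovacuum,
  four-dimensional spacetime containing a spacelike, connected, acausal hypersurface `S`, such
  that `S̄` is a topological manifold with boundary consisting of the union of a compact set and
  of a finite number of asymptotically-flat ends. Suppose that there exists on `M` a complete
  hypersurface-orthogonal Killing vector, that the domain of outer communication `⟨⟨M_ext⟩⟩` is
  globally hyperbolic, and that `∂S̄ ⊂ M ∖ ⟨⟨M_ext⟩⟩`. Then `⟨⟨M_ext⟩⟩` is isometric to the
  domain of outer communications of a Reissner–Nordström or a Majumdar–Papapetrou spacetime."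
  Neither analyticity nor non-degeneracy nor connectedness of the horizon is assumed.
* Chruściel–Galloway 2010, **Theorem 1.1**: "`I⁺`-regular stationary domains of outer
  communication `⟨⟨M_ext⟩⟩` satisfying the null energy condition do not contain prehorizons, the
  union of which is closed within `⟨⟨M_ext⟩⟩`" — the technical result which replaces analyticity
  (used before only to exclude null orbits of the static Killing vector inside the d.o.c.); its
  **Theorem 4.1** is the vacuum classification in dimension `n + 1`, `n ≥ 3`, under the same
  global hypotheses as Theorem 3.1 above plus "the doubled manifold `Ŝ` is of positive energy
  type", a hypothesis which holds in space dimension `n = 3` (loc. cit., §4, by Schoen's and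
  Witten's positive energy theorems) and is accordingly absent from the four-dimensional
  Theorem 3.1 of the 2012 review; §3 of the same paper gives the alternative maximal-hypersurface
  argument (Chruściel–Wald 1994, Sudarsky–Wald 1993) for non-degenerate horizons.

## Main definitions (namespace `Literature.Geometry.Lorentzian`)

* `PseudoRiemannianMetric.twistForm g X x u v w` — the Frobenius `3`-form `(X♭ ∧ dX♭)_x (u, v, w)`
  of a vector field `X`, written through the Levi-Civita connection
  (`dX♭(v, w) = g(∇_v X, w) − g(∇_w X, v)`); `PseudoRiemannianMetric.IsHypersurfaceOrthogonalOn
  g X A` — `X♭ ∧ dX♭ = 0` at every point of `A ⊆ M`.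
* `StationaryAFBlackHole.IsStatic 𝓑` — the stationary Killing field of `𝓑` is
  hypersurface-orthogonal **on all of `M`** (as printed in Theorem 3.1: "there exists on `M` a
  complete hypersurface-orthogonal Killing vector").
* `StationaryAFBlackHole.IsIsometricToSchwarzschildExterior 𝓑 hF hP hres` — the conclusion:
  `⟨⟨M_ext⟩⟩` is isometric to the Schwarzschild exterior `{r > 2M}` of some mass `M > 0`
  (`Kerr.exterior M 0` with `Kerr.smoothMetric M 0 r₊`); it implies the Kerr conclusion
  `IsIsometricToKerrExterior` of gr.S23 (`(M, 0)` is subextremal).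
* `static_black_hole_uniqueness IsRegular` — the static classification theorem as a **statement
  schema** in its global-regularity hypothesis, exactly parallel to
  `stationary_black_hole_uniqueness` (requested in this form by route
  `FinalStateConjecture/SignedCensus`, crux `StaticAnchor`): every `IsRegular`, static, vacuum
  stationary AF black hole with non-empty future event horizon has d.o.c. isometric to a
  Schwarzschild exterior. Companion lemmas: `.apply`, `.mono`, `.alexakisIonescuKlainermanRigidity`
  (a static uniqueness schema yields the AIK/no-hair schema of `BlackHoles.lean` at the predicate
  strengthened by staticity and non-emptiness of the horizon).
* `StationaryAFBlackHole.IsSliceRegular 𝓑` — an expressible global-regularity predicate which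
  **implies** the printed global hypotheses of Theorem 3.1 for `S := 𝓑.embed(X)` (see Design
  choices): the embedded slice is closed and acausal in `M`, the slice has exactly one end
  (`AFEnd.IsSoleEnd`: compact outside a far region), and `M` is globally hyperbolic.
* `ChruscielGalloway2010_staticUniqueness` — the **named fact** (D-0014): the schema at
  `IsSliceRegular`, i.e. the vacuum case of Theorem 3.1 restricted to this (smaller) class of
  space-times; `ChruscielGalloway2010_staticUniqueness.apply` is its hypothesis form.
* `StationaryAFBlackHole.IsBoundedSliceRegular 𝓑`, `ChruscielCostaHeusler2012_staticUniquenessWithBoundary`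
  (APPENDED, item `wi-97107`): the same with the slice allowed a BOUNDARY `∂S̄ = S̄ ∖ S ⊆ M ∖ ⟨⟨M_ext⟩⟩`, as
  printed in Theorem 3.1 (`S̄` a topological `3`-manifold with boundary, compact modulo the AF end) — the
  generality met by the collar models `{r > ρ} × ℝ`; a second named fact (D-0014), hypothesis form `.apply`.

## Design choices

* **Staticity through `∇`.** For the metric (torsion-free) connection,
  `dX♭(v, w) = (∇_v X♭)(w) − (∇_w X♭)(v) = g(∇_v X, w) − g(∇_w X, v)`, so
  `(X♭ ∧ dX♭)(u, v, w) = Σ_cyclic X♭(u) · dX♭(v, w)` is the function `twistForm`; its vanishing is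
  the Frobenius integrability condition of the distribution `X^⊥` (Wald 1984, App. B.3,
  Thm. B.3.2 and (7.1.1): `ξ_{[a} ∇_b ξ_{c]} = 0`). No differential forms on manifolds are needed.
  The definition binds the standing Levi-Civita hypothesis `[g.HasLeviCivita]` like the Killing
  notions of `LeviCivita.lean`/`Stationary.lean`.
* **Static on `M`, not only on `⟨⟨M_ext⟩⟩`.** Theorem 3.1 (and Chruściel–Galloway's Thm. 4.1)
  print "on `M`"; the work-item's paraphrase "hypersurface-orthogonal on the d.o.c." would be a
  *weaker hypothesis*, hence a *stronger* named fact than printed, and is not used.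
* **Schema first.** As for gr.S23 (see the Design choices of `BlackHoles.lean`), the printed global
  hypotheses speak of the closure `S̄ ⊆ M` being a topological manifold with boundary, compact
  modulo finitely many asymptotically flat ends, with `∂S̄ := S̄ ∖ S` outside the d.o.c.; the
  theorem *as printed* is the schema `static_black_hole_uniqueness` at the transcription of these
  hypotheses, documented here and not asserted in that generality.
* **The asserted instance.** Unlike `I⁺`-regularity (Chruściel–Costa 2008, Def. 1.1, which asks
  `∂S̄ ⊆ 𝓔⁺` to meet every generator of `𝓔⁺` once), the hypotheses of Theorem 3.1 *are* implied by
  an expressible predicate, `IsSliceRegular`, for the slice `S := 𝓑.embed(X)` of the hypothesis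
  structure: `S` is a connected (`ConnectedSpace X`) spacelike (unit timelike normal, induced
  Riemannian data `h`) embedded hypersurface (`isSmoothEmbedding`); it is assumed **acausal** and
  **closed** in `M`, so that `S̄ = S` is a topological `3`-manifold (homeomorphic to `X`) with
  *empty* manifold boundary and `∂S̄ = S̄ ∖ S = ∅ ⊆ M ∖ ⟨⟨M_ext⟩⟩` trivially; `X` is the union of a
  compact set and of **one** asymptotically flat end (`𝓑.e.IsSoleEnd` together with the decay
  field `isAsymptoticallyFlat` of the structure, Chruściel–Costa 2008, §2.1, and `induced_h`,
  `induced_k`); the stationary Killing field is complete and timelike on `M_ext` (structure) and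
  hypersurface-orthogonal on `M` (`IsStatic`); and **`M` itself is assumed globally hyperbolic**,
  which implies global hyperbolicity of the open, causally convex subset
  `⟨⟨M_ext⟩⟩ = I⁺(M_ext) ∩ I⁻(M_ext)` (`I⁺` followed by `J⁺` is `I⁺`, O'Neill 1983, Ch. 14,
  Cor. 14.1, so causal diamonds of points of the d.o.c. computed in `M` lie in the d.o.c. and are
  compact). Every clause only *adds* hypotheses relative to the printed theorem, so the named fact
  `ChruscielGalloway2010_staticUniqueness` asserts no more than Theorem 3.1 (vacuum case:
  `Ric(g) = 0` is electrovacuum with `F = 0`, and a Ricci-flat member of the Reissner–Nordström /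
  Majumdar–Papapetrou families is a Schwarzschild space-time, `M ≥ 0`). The hypothesis
  `𝓑.horizon.Nonempty` (there *is* a black hole) excludes the massless member: the d.o.c. of
  Minkowski space-time is the whole of it, and Minkowski space-time — timelike geodesically
  complete and globally hyperbolic — admits no extension (Galloway–Ling–Sbierski 2017, Thm. 1.2),
  whereas a non-empty `𝓔⁺ ⊆ ∂⟨⟨M_ext⟩⟩` (`futureEventHorizonOfEnd_eq_frontier_docOfEnd_inter`)
  makes `M` a proper extension of its d.o.c.; hence `M > 0` and the d.o.c. of the Schwarzschild
  space-time is the exterior `{r > 2M} = Kerr.exterior M 0` (`Kerr.rPlus_zero_right`). This is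
  the same reading of "a Kerr/Schwarzschild space-time" as in `IsIsometricToKerrExterior`.
* **Not here.** The electrovacuum conclusion (Reissner–Nordström / Majumdar–Papapetrou; no
  Maxwell fields in the prelude), the higher-dimensional Theorem 4.1, the no-prehorizon
  Theorem 1.1 itself (no prehorizons in the prelude), and the Sudarsky–Wald staticity theorem
  (non-rotating `⇒` static), which is a different result.

## References

* P. T. Chruściel, G. J. Galloway, *Uniqueness of static black holes without analyticity*,
  Class. Quantum Grav. 27 (2010) 152001, arXiv:1004.0513, Thm. 1.1, §3, Thm. 4.1
  (key `ChruscielGalloway2010`).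
* P. T. Chruściel, J. L. Costa, M. Heusler, *Stationary black holes: uniqueness and beyond*,
  Living Rev. Relativity 15 (2012) 7, arXiv:1205.6112, §3.1 and Theorem 3.1
  (key `ChruscielCostaHeusler2012`).
* P. T. Chruściel, J. L. Costa, *On uniqueness of stationary vacuum black holes*, Astérisque 321
  (2008) 195–265, arXiv:0806.0016, §2.1 (key `ChruscielCosta2008`).
* R. M. Wald, *General Relativity*, Chicago 1984, §7.1, (7.1.1) and App. B.3 (Frobenius)
  (key `Wald1984`).
* B. O'Neill, *Semi-Riemannian geometry*, Academic Press 1983, Ch. 12 (static space-times),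
  Ch. 14 (key `ONeill1983`).
* G. J. Galloway, E. Ling, J. Sbierski, *Timelike completeness as an obstruction to
  `C⁰`-extensions*, Commun. Math. Phys. 359 (2018), Thm. 1.2 (key `GallowayLingSbierski2017`).
-/

noncomputable section

open Bundle Set Manifold TopologicalSpace Filter
open scoped ContDiff Topology Manifold

universe u

namespace Literature.Geometry.Lorentzian

/-! ### Hypersurface-orthogonal vector fields (Frobenius form) -/

namespace PseudoRiemannianMetric

variable {E : Type*} [NormedAddCommGroup E] [NormedSpace ℝ E] {H : Type*} [TopologicalSpace H]
  {I : ModelWithCorners ℝ E H} {M : Type*} [TopologicalSpace M] [ChartedSpace H M]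
  [IsManifold I ∞ M] {n : ℕ∞ω}

variable [FiniteDimensional ℝ E] [CompleteSpace E] [Fact (1 ≤ n)]
  (g : PseudoRiemannianMetric I n E (TangentSpace I : M → Type _)) [g.HasLeviCivita]

/-- The **twist (Frobenius) `3`-form** `(X♭ ∧ dX♭)_x (u, v, w)` of the vector field `X` at `x`,
written through the Levi-Civita connection: with `X♭ = g(X, ·)` and, `∇` being torsion-free and
metric, `dX♭(v, w) = g(∇_v X, w) − g(∇_w X, v)`, it is the cyclic sum
`X♭(u) dX♭(v, w) + X♭(v) dX♭(w, u) + X♭(w) dX♭(u, v)` (recall Mathlib's argument order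
`g.leviCivita X x v = ∇_v X`). For a Killing field `ξ` this is `6 ξ_{[a} ∇_b ξ_{c]} uᵃ vᵇ wᶜ`.
Wald 1984, §7.1, (7.1.1) and App. B.3; Chruściel–Costa–Heusler 2012, §3.1 (`X ∧ dX`). Standing
hypothesis `[g.HasLeviCivita]`. [cite: Wald1984, §7.1 (7.1.1) and App. B.3] -/
def twistForm (X : Π x : M, TangentSpace I x) (x : M) (u v w : TangentSpace I x) : ℝ :=
  g.val x (X x) u * (g.val x (g.leviCivita X x v) w - g.val x (g.leviCivita X x w) v) +
    g.val x (X x) v * (g.val x (g.leviCivita X x w) u - g.val x (g.leviCivita X x u) w) +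
    g.val x (X x) w * (g.val x (g.leviCivita X x u) v - g.val x (g.leviCivita X x v) u)

/-- The vector field `X` is **hypersurface-orthogonal on `A ⊆ M`**: its twist form vanishes at
every point of `A`, `X♭ ∧ dX♭ = 0` — by Frobenius' theorem (where `X ≠ 0`) the distribution of
hyperplanes `X^⊥` is integrable, i.e. `X` is orthogonal to a local foliation by hypersurfaces. A
stationary space-time whose Killing field is hypersurface-orthogonal is *static*
(`StationaryAFBlackHole.IsStatic`). Wald 1984, §7.1, (7.1.1), App. B.3 (Thm. B.3.2);
Chruściel–Costa–Heusler 2012, §3.1. [cite: ChruscielCostaHeusler2012, §3.1] -/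
def IsHypersurfaceOrthogonalOn (X : Π x : M, TangentSpace I x) (A : Set M) : Prop :=
  ∀ x ∈ A, ∀ u v w : TangentSpace I x, g.twistForm X x u v w = 0

variable {g}

omit [FiniteDimensional ℝ E] [CompleteSpace E] [Fact (1 ≤ n)] in
/-- Unfolding lemma for `IsHypersurfaceOrthogonalOn`. [folklore] -/
lemma isHypersurfaceOrthogonalOn_iff (X : Π x : M, TangentSpace I x) (A : Set M) :
    g.IsHypersurfaceOrthogonalOn X A ↔
      ∀ x ∈ A, ∀ u v w : TangentSpace I x, g.twistForm X x u v w = 0 :=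
  Iff.rfl

omit [FiniteDimensional ℝ E] [CompleteSpace E] [Fact (1 ≤ n)] in
/-- The twist form is alternating: it vanishes when the first two arguments agree
(`X♭ ∧ dX♭` is a `3`-form). Wald 1984, App. B.3. [folklore] -/
lemma twistForm_self_left (X : Π x : M, TangentSpace I x) (x : M) (u w : TangentSpace I x) :
    g.twistForm X x u u w = 0 := by
  simp only [twistForm]
  ring

omit [FiniteDimensional ℝ E] [CompleteSpace E] [Fact (1 ≤ n)] in
/-- The twist form is alternating: it vanishes when the last two arguments agree.
Wald 1984, App. B.3. [folklore] -/
lemma twistForm_self_right (X : Π x : M, TangentSpace I x) (x : M) (u v : TangentSpace I x) :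
    g.twistForm X x u v v = 0 := by
  simp only [twistForm]
  ring

omit [FiniteDimensional ℝ E] [CompleteSpace E] [Fact (1 ≤ n)] in
/-- The twist form is invariant under cyclic permutation of its arguments (`X♭ ∧ dX♭` is a
`3`-form). Wald 1984, App. B.3. [folklore] -/
lemma twistForm_cyclic (X : Π x : M, TangentSpace I x) (x : M) (u v w : TangentSpace I x) :
    g.twistForm X x v w u = g.twistForm X x u v w := by
  simp only [twistForm]
  ring

omit [FiniteDimensional ℝ E] [CompleteSpace E] [Fact (1 ≤ n)] in
/-- The zero vector field has vanishing twist form. [folklore] -/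
lemma twistForm_zero (x : M) (u v w : TangentSpace I x) :
    g.twistForm (0 : Π x : M, TangentSpace I x) x u v w = 0 := by
  simp [twistForm]

omit [FiniteDimensional ℝ E] [CompleteSpace E] [Fact (1 ≤ n)] in
/-- The zero vector field is hypersurface-orthogonal on every set (degenerate example: the
definition is a condition on `X♭ ∧ dX♭` only). [folklore] -/
lemma isHypersurfaceOrthogonalOn_zero (A : Set M) :
    g.IsHypersurfaceOrthogonalOn (0 : Π x : M, TangentSpace I x) A :=
  fun x _ u v w ↦ twistForm_zero x u v w

omit [FiniteDimensional ℝ E] [CompleteSpace E] [Fact (1 ≤ n)] in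
/-- Hypersurface-orthogonality on a set is inherited by subsets. [folklore] -/
lemma IsHypersurfaceOrthogonalOn.mono {X : Π x : M, TangentSpace I x} {A B : Set M}
    (h : g.IsHypersurfaceOrthogonalOn X B) (hAB : A ⊆ B) : g.IsHypersurfaceOrthogonalOn X A :=
  fun x hx ↦ h x (hAB hx)

omit [FiniteDimensional ℝ E] [CompleteSpace E] [Fact (1 ≤ n)] in
/-- Every vector field is (vacuously) hypersurface-orthogonal on the empty set. [folklore] -/
lemma isHypersurfaceOrthogonalOn_empty (X : Π x : M, TangentSpace I x) :
    g.IsHypersurfaceOrthogonalOn X ∅ :=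
  fun _ hx ↦ hx.elim

end PseudoRiemannianMetric

/-! ### Static black holes and the Schwarzschild conclusion -/

namespace StationaryAFBlackHole

variable (𝓑 : StationaryAFBlackHole.{u})

/-- The stationary asymptotically flat black hole `𝓑` is **static**: its stationary Killing field
`X = 𝓑.killing` (complete, timelike on `M_ext`) is hypersurface-orthogonal on the whole
space-time `M`, `X♭ ∧ dX♭ = 0` (`IsHypersurfaceOrthogonalOn … univ`). This is the hypothesis
"there exists on `M` a complete hypersurface-orthogonal Killing vector" of the static
classification theorem, Chruściel–Costa–Heusler 2012, §3.1 and Thm. 3.1 (a predicate on the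
datum `𝓑`, under the standing Levi-Civita hypothesis; nothing to discharge). [cite: ChruscielCostaHeusler2012, §3.1 and Thm. 3.1] -/
def IsStatic [𝓑.metric.HasLeviCivita] : Prop :=
  𝓑.metric.toPseudoRiemannianMetric.IsHypersurfaceOrthogonalOn 𝓑.killing univ

variable {𝓑} in
/-- Unfolding lemma: `𝓑` is static iff the twist form of its Killing field vanishes everywhere.
Chruściel–Costa–Heusler 2012, §3.1. [folklore] -/
lemma isStatic_iff [𝓑.metric.HasLeviCivita] :
    𝓑.IsStatic ↔ ∀ (x : 𝓑.carrier) (u v w : TangentSpace (𝓡 4) x),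
      𝓑.metric.toPseudoRiemannianMetric.twistForm 𝓑.killing x u v w = 0 := by
  simp [IsStatic, PseudoRiemannianMetric.IsHypersurfaceOrthogonalOn]

variable {𝓑} in
/-- A static black hole has its Killing field hypersurface-orthogonal on every region, in
particular on the domain of outer communications. [folklore] -/
lemma IsStatic.isHypersurfaceOrthogonalOn [𝓑.metric.HasLeviCivita] (h : 𝓑.IsStatic)
    (A : Set 𝓑.carrier) :
    𝓑.metric.toPseudoRiemannianMetric.IsHypersurfaceOrthogonalOn 𝓑.killing A :=
  PseudoRiemannianMetric.IsHypersurfaceOrthogonalOn.mono h (subset_univ A)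

/-- **The domain of outer communications of `𝓑` is isometric to a Schwarzschild exterior**:
there is a mass `M > 0` and a `C^∞` diffeomorphism `Φ` from the open submanifold
`⟨⟨M_ext⟩⟩ = 𝓑.docOpens hF hP` onto the ingoing Eddington–Finkelstein (Kerr–Schild, `a = 0`)
exterior chart `Kerr.exterior M 0 = {r > 2M}` pulling the `C^∞` Schwarzschild metric
`Kerr.smoothMetric M 0 r₊` back to the restriction of `𝓑.metric` (an isometry,
`PseudoRiemannianMetric.IsIsometry`). This is the conclusion "`⟨⟨M_ext⟩⟩` is isometric to the
domain of outer communications of a Schwarzschild space-time" of the static classification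
theorem (Chruściel–Costa–Heusler 2012, Thm. 3.1, vacuum case; Chruściel–Galloway 2010, Thm. 4.1)
for a space-time that does contain a black hole (`M > 0`; cf. `IsIsometricToKerrExterior`, of
which it is the case `a = 0`). Openness of the d.o.c. and smoothness of the restricted metric are
the prelude's named facts `hF`, `hP`, `hres`; the metric needs `[Kerr.Facts]`. [folklore] -/
def IsIsometricToSchwarzschildExterior [Kerr.Facts]
    (hF : 𝓑.metric.isOpen_chronologicalFuture 𝓑.timeOrientation)
    (hP : 𝓑.metric.isOpen_chronologicalPast 𝓑.timeOrientation)
    (hres : PseudoRiemannianMetric.contMDiff_restrict (I := 𝓡 4) (n := ∞) (M := 𝓑.carrier)) :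
    Prop :=
  ∃ (M : ℝ) (_ : 0 < M)
    (Φ : Diffeomorph (𝓡 4) 𝓘(ℝ, E4) (𝓑.docOpens hF hP) (Kerr.exterior M 0) ∞),
    PseudoRiemannianMetric.IsIsometry
      (𝓑.metric.restrict hres (𝓑.docOpens hF hP)).toPseudoRiemannianMetric
      (Kerr.smoothMetric M 0 (Kerr.rPlus M 0)).toPseudoRiemannianMetric Φ

variable {𝓑} in
/-- A d.o.c. isometric to a Schwarzschild exterior of mass `M > 0` is isometric to a subextremal
Kerr exterior (`a = 0`, `|0| < M`): the Schwarzschild conclusion implies the Kerr conclusion of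
gr.S23. O'Neill 1995, Ch. 2, §2.3 (`a = 0` is Schwarzschild). [folklore] -/
theorem IsIsometricToSchwarzschildExterior.isIsometricToKerrExterior [Kerr.Facts]
    {hF : 𝓑.metric.isOpen_chronologicalFuture 𝓑.timeOrientation}
    {hP : 𝓑.metric.isOpen_chronologicalPast 𝓑.timeOrientation}
    {hres : PseudoRiemannianMetric.contMDiff_restrict (I := 𝓡 4) (n := ∞) (M := 𝓑.carrier)}
    (h : 𝓑.IsIsometricToSchwarzschildExterior hF hP hres) :
    𝓑.IsIsometricToKerrExterior hF hP hres := by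
  obtain ⟨M, hM, Φ, hΦ⟩ := h
  have hsub : Kerr.IsSubextremal M 0 := by
    simpa [Kerr.IsSubextremal] using hM
  exact ⟨M, 0, hsub, Φ, hΦ⟩

/-- **Slice regularity**, an expressible strengthening of the global hypotheses of the static
classification theorem (Chruściel–Costa–Heusler 2012, Thm. 3.1) for the slice `S := 𝓑.embed(X)`
of the hypothesis structure: (i) `S` is **closed** in `M` (so `S̄ = S`, a topological `3`-manifold
homeomorphic to `X` by `isSmoothEmbedding`, with empty boundary `∂S̄ = S̄ ∖ S = ∅ ⊆ M ∖ ⟨⟨M_ext⟩⟩`);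
(ii) `S` is **acausal** (no two distinct points of `S` are joined by a future causal curve;
`J⁺` is `causalFuture`); (iii) the slice has **exactly one end**, the asymptotically flat end `e`
(`AFEnd.IsSoleEnd`: the complement of a far region is compact, so `S̄ = S` is the union of a
compact set and of one asymptotically flat end, the decay being the structure field
`isAsymptoticallyFlat`, Chruściel–Costa 2008, §2.1); (iv) `M` is **globally hyperbolic**
(whence so is the open, causally convex d.o.c. `I⁺(M_ext) ∩ I⁻(M_ext)`). Spacelikeness and
connectedness of `S` are structure fields. See the module docstring, *The asserted instance*. [cite: ChruscielCostaHeusler2012, Thm. 3.1 (hypotheses)] -/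
def IsSliceRegular (𝓑 : StationaryAFBlackHole.{u}) : Prop :=
  IsClosed (Set.range 𝓑.embed) ∧
    (∀ p ∈ Set.range 𝓑.embed, ∀ q ∈ Set.range 𝓑.embed,
      q ∈ 𝓑.metric.causalFuture 𝓑.timeOrientation {p} → q = p) ∧
    𝓑.e.IsSoleEnd ∧ 𝓑.metric.IsGloballyHyperbolic 𝓑.timeOrientation

variable {𝓑} in
/-- A slice-regular black hole has a closed embedded slice (clause (i)). [folklore] -/
lemma IsSliceRegular.isClosed_range (h : 𝓑.IsSliceRegular) : IsClosed (Set.range 𝓑.embed) :=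
  h.1

variable {𝓑} in
/-- A slice-regular black hole has an acausal embedded slice (clause (ii)). [folklore] -/
lemma IsSliceRegular.acausal (h : 𝓑.IsSliceRegular) {p q : 𝓑.carrier}
    (hp : p ∈ Set.range 𝓑.embed) (hq : q ∈ Set.range 𝓑.embed)
    (hpq : q ∈ 𝓑.metric.causalFuture 𝓑.timeOrientation {p}) : q = p :=
  h.2.1 p hp q hq hpq

variable {𝓑} in
/-- A slice-regular black hole has a one-ended slice (clause (iii)). [folklore] -/
lemma IsSliceRegular.isSoleEnd (h : 𝓑.IsSliceRegular) : 𝓑.e.IsSoleEnd :=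
  h.2.2.1

variable {𝓑} in
/-- A slice-regular black hole is globally hyperbolic (clause (iv)). [folklore] -/
lemma IsSliceRegular.isGloballyHyperbolic (h : 𝓑.IsSliceRegular) :
    𝓑.metric.IsGloballyHyperbolic 𝓑.timeOrientation :=
  h.2.2.2

end StationaryAFBlackHole

/-! ### The static classification theorem: schema and named fact -/

/-- **Uniqueness of static vacuum black holes without analyticity**, as a **statement schema**
in the global-regularity hypothesis (parallel to gr.S23 `stationary_black_hole_uniqueness`).
For a predicate `IsRegular` on stationary asymptotically flat black holes,
`static_black_hole_uniqueness IsRegular` says: every stationary AF black hole `𝓑` (hypothesis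
structure `StationaryAFBlackHole`: complete stationary Killing field timelike on `M_ext`, AF end)
which is `IsRegular`, **static** (`IsStatic`: the Killing field is hypersurface-orthogonal on
`M`), **vacuum** (`Ric(g) = 0`) and has **non-empty** future event horizon `𝓔⁺` has domain of
outer communications isometric to a Schwarzschild exterior `{r > 2M}`, `M > 0`
(`IsIsometricToSchwarzschildExterior`) — **no analyticity, no non-degeneracy and no
connectedness of `𝓔⁺` assumed**. Chruściel–Costa–Heusler 2012, Theorem 3.1 as printed — "Let
`(M, g)` be an electrovacuum, four-dimensional spacetime containing a spacelike, connected,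
acausal hypersurface `S`, such that `S̄` is a topological manifold with boundary consisting of
the union of a compact set and of a finite number of asymptotically-flat ends. Suppose that
there exists on `M` a complete hypersurface-orthogonal Killing vector, that the domain of outer
communication `⟨⟨M_ext⟩⟩` is globally hyperbolic, and that `∂S̄ ⊂ M ∖ ⟨⟨M_ext⟩⟩`. Then `⟨⟨M_ext⟩⟩`
is isometric to the domain of outer communications of a Reissner–Nordström or a
Majumdar–Papapetrou spacetime" (analyticity removed by Chruściel–Galloway 2010, Thm. 1.1; vacuum
`n + 1`-dimensional version: their Thm. 4.1) — is, in vacuum, this schema **at the transcription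
of these global hypotheses**, documented here and not asserted in that generality (the closure
`S̄` "a topological manifold with boundary, compact modulo finitely many AF ends" is not a prelude
notion); the instance at the stronger, expressible predicate `StationaryAFBlackHole.IsSliceRegular`
is the named fact `ChruscielGalloway2010_staticUniqueness`. Instance hypotheses and the parameters
`hF hP hres` are the prelude's standing named facts, as in gr.S23. [cite: ChruscielCostaHeusler2012, Thm. 3.1 (schema)] -/
def static_black_hole_uniqueness (IsRegular : StationaryAFBlackHole.{u} → Prop) : Prop :=
  ∀ (𝓑 : StationaryAFBlackHole.{u}) [𝓑.metric.HasLeviCivita] [Kerr.Facts]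
    (hF : 𝓑.metric.isOpen_chronologicalFuture 𝓑.timeOrientation)
    (hP : 𝓑.metric.isOpen_chronologicalPast 𝓑.timeOrientation)
    (hres : PseudoRiemannianMetric.contMDiff_restrict (I := 𝓡 4) (n := ∞) (M := 𝓑.carrier)),
    IsRegular 𝓑 → 𝓑.IsStatic → 𝓑.metric.toPseudoRiemannianMetric.IsRicciFlat →
    𝓑.horizon.Nonempty → 𝓑.IsIsometricToSchwarzschildExterior hF hP hres

/-- Hypothesis form of the static uniqueness schema: if `static_black_hole_uniqueness IsRegular`
holds, then an `IsRegular`, static, vacuum stationary AF black hole with non-empty horizon has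
d.o.c. isometric to a Schwarzschild exterior. Tautological unfolding (Chruściel–Costa–Heusler
2012, Thm. 3.1). [folklore] -/
theorem static_black_hole_uniqueness.apply {IsRegular : StationaryAFBlackHole.{u} → Prop}
    (h : static_black_hole_uniqueness IsRegular) (𝓑 : StationaryAFBlackHole.{u})
    [𝓑.metric.HasLeviCivita] [Kerr.Facts]
    (hF : 𝓑.metric.isOpen_chronologicalFuture 𝓑.timeOrientation)
    (hP : 𝓑.metric.isOpen_chronologicalPast 𝓑.timeOrientation)
    (hres : PseudoRiemannianMetric.contMDiff_restrict (I := 𝓡 4) (n := ∞) (M := 𝓑.carrier))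
    (hreg : IsRegular 𝓑) (hstat : 𝓑.IsStatic)
    (hvac : 𝓑.metric.toPseudoRiemannianMetric.IsRicciFlat) (hne : 𝓑.horizon.Nonempty) :
    𝓑.IsIsometricToSchwarzschildExterior hF hP hres :=
  h 𝓑 hF hP hres hreg hstat hvac hne

/-- The static uniqueness schema is antitone in the regularity predicate: a schema valid under a
weaker regularity hypothesis `P` holds under any stronger one `Q`. [folklore] -/
theorem static_black_hole_uniqueness.mono {P Q : StationaryAFBlackHole.{u} → Prop}
    (hPQ : ∀ 𝓑, Q 𝓑 → P 𝓑) (h : static_black_hole_uniqueness P) :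
    static_black_hole_uniqueness Q :=
  fun 𝓑 _ _ hF hP hres hQ hstat hvac hne ↦ h 𝓑 hF hP hres (hPQ 𝓑 hQ) hstat hvac hne

/-- **Static uniqueness feeds the no-hair schema.** The static uniqueness schema at `IsRegular`
yields the Alexakis–Ionescu–Klainerman / gr.S23 rigidity schema of `BlackHoles.lean` at the
predicate "`IsRegular`, static, non-empty horizon": a Schwarzschild exterior is a subextremal
Kerr exterior (`IsIsometricToSchwarzschildExterior.isIsometricToKerrExterior`). This is the shape
in which route `FinalStateConjecture/SignedCensus` (crux `StaticAnchor`: non-rotating `⇒` static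
`⇒` Schwarzschild) consumes the theorem. Chruściel–Costa–Heusler 2012, §3.3.1 (the non-rotating
branch ends with Theorem 3.1). [folklore] -/
theorem static_black_hole_uniqueness.alexakisIonescuKlainermanRigidity
    {IsRegular : StationaryAFBlackHole.{u} → Prop} (h : static_black_hole_uniqueness IsRegular) :
    AlexakisIonescuKlainermanRigidity.{u} fun 𝓑 ↦
      IsRegular 𝓑 ∧ (∀ [𝓑.metric.HasLeviCivita], 𝓑.IsStatic) ∧ 𝓑.horizon.Nonempty := by
  intro 𝓑 _ _ hF hP hres hyp hvac
  exact (h 𝓑 hF hP hres hyp.1 hyp.2.1 hvac hyp.2.2).isIsometricToKerrExterior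

/-- **Chruściel–Galloway: uniqueness of static vacuum black holes without analyticity** (named
fact, D-0014): the static uniqueness schema at the slice-regularity predicate
`StationaryAFBlackHole.IsSliceRegular`. Explicitly: let `𝓑` be a four-dimensional stationary
asymptotically flat black-hole space-time (`StationaryAFBlackHole`) whose embedded slice
`S = 𝓑.embed(X)` is closed and acausal in `M` with `X` compact outside its asymptotically flat
end, with `M` globally hyperbolic, whose (complete) stationary Killing field is
hypersurface-orthogonal on `M` (static), which is vacuum, `Ric(g) = 0`, **smooth but not assumed
analytic**, with no hypothesis on degeneracy or connectedness of the horizon; if the future event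
horizon `𝓔⁺` is non-empty, then `⟨⟨M_ext⟩⟩` is isometric to the Schwarzschild exterior `{r > 2M}`
for some `M > 0`. These hypotheses imply those printed in Chruściel–Costa–Heusler 2012, Thm. 3.1
(`S̄ = S` is a topological manifold with empty boundary, the union of a compact set and one AF end;
`∂S̄ = ∅ ⊆ M ∖ ⟨⟨M_ext⟩⟩`; the causally convex open d.o.c. of a globally hyperbolic `M` is globally
hyperbolic), whose vacuum conclusion is a Schwarzschild space-time, of positive mass as soon as
there is a horizon (module docstring, *The asserted instance*); the removal of analyticity is
Chruściel–Galloway 2010, Thm. 1.1 (with Thm. 4.1 for the vacuum classification). Hypothesis form: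
`ChruscielGalloway2010_staticUniqueness.apply`. [cite: ChruscielCostaHeusler2012, Thm. 3.1 (vacuum case); analyticity removed by ChruscielGalloway2010 Thm. 1.1, Thm. 4.1] -/
def ChruscielGalloway2010_staticUniqueness : Prop :=
  static_black_hole_uniqueness.{u} StationaryAFBlackHole.IsSliceRegular

/-- **Chruściel–Galloway static uniqueness, hypothesis form.** Given the named fact
`ChruscielGalloway2010_staticUniqueness`, a stationary AF vacuum black hole with closed acausal
one-ended slice in a globally hyperbolic space-time, static Killing field and non-empty horizon
has d.o.c. isometric to a Schwarzschild exterior `{r > 2M}`, `M > 0`. Chruściel–Costa–Heusler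
2012, Thm. 3.1; Chruściel–Galloway 2010. Tautological unfolding. [folklore] -/
theorem ChruscielGalloway2010_staticUniqueness.apply
    (h : ChruscielGalloway2010_staticUniqueness.{u}) (𝓑 : StationaryAFBlackHole.{u})
    [𝓑.metric.HasLeviCivita] [Kerr.Facts]
    (hF : 𝓑.metric.isOpen_chronologicalFuture 𝓑.timeOrientation)
    (hP : 𝓑.metric.isOpen_chronologicalPast 𝓑.timeOrientation)
    (hres : PseudoRiemannianMetric.contMDiff_restrict (I := 𝓡 4) (n := ∞) (M := 𝓑.carrier))
    (hclosed : IsClosed (Set.range 𝓑.embed))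
    (hacausal : ∀ p ∈ Set.range 𝓑.embed, ∀ q ∈ Set.range 𝓑.embed,
      q ∈ 𝓑.metric.causalFuture 𝓑.timeOrientation {p} → q = p)
    (hend : 𝓑.e.IsSoleEnd) (hgh : 𝓑.metric.IsGloballyHyperbolic 𝓑.timeOrientation)
    (hstat : 𝓑.IsStatic) (hvac : 𝓑.metric.toPseudoRiemannianMetric.IsRicciFlat)
    (hne : 𝓑.horizon.Nonempty) :
    𝓑.IsIsometricToSchwarzschildExterior hF hP hres :=
  h 𝓑 hF hP hres ⟨hclosed, hacausal, hend, hgh⟩ hstat hvac hne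

/-- The named fact also yields the Kerr-type (gr.S23 / AIK-schema) conclusion at the predicate
"slice-regular, static, non-empty horizon" (`static_black_hole_uniqueness.alexakisIonescuKlainermanRigidity`).
Chruściel–Costa–Heusler 2012, §3.3.1. [folklore] -/
theorem ChruscielGalloway2010_staticUniqueness.alexakisIonescuKlainermanRigidity
    (h : ChruscielGalloway2010_staticUniqueness.{u}) :
    AlexakisIonescuKlainermanRigidity.{u} fun 𝓑 ↦
      𝓑.IsSliceRegular ∧ (∀ [𝓑.metric.HasLeviCivita], 𝓑.IsStatic) ∧ 𝓑.horizon.Nonempty :=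
  static_black_hole_uniqueness.alexakisIonescuKlainermanRigidity h


/-! ### Slices WITH boundary: the printed generality of Theorem 3.1 (`∂S̄ ⊂ M ∖ ⟨⟨M_ext⟩⟩`)

Requested by route `FinalStateConjecture/RootDecompStaticJunction` (item `wi-97107`, rung `StaticNoHair`): the
predicate `IsSliceRegular` above asks the embedded slice to be CLOSED in `M` with compact core, which no collar model
`{r > ρ} × ℝ` of a Schwarzschild black hole satisfies (its slices `{x⁰ = c}` have non-compact core `{ρ < r ≤ R}`), whereas
the printed Theorem 3.1 allows `S̄` to be a manifold WITH BOUNDARY, `∂S̄ ⊂ M ∖ ⟨⟨M_ext⟩⟩` — e.g. `S̄ = {x⁰ = 0, r ≥ ρ′}`,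
`ρ < ρ′ ≤ 2M`, with `∂S̄ = {r = ρ′}` inside the black hole.  `IsBoundedSliceRegular` transcribes these printed global
hypotheses for the slice `S := 𝓑.embed(X)` (now NOT assumed closed in `M`), every clause implying the corresponding printed
one; the named fact `ChruscielCostaHeusler2012_staticUniquenessWithBoundary` is the schema at this predicate. -/

namespace StationaryAFBlackHole

variable (𝓑 : StationaryAFBlackHole.{u})

/-- **Slice regularity with boundary** — the global hypotheses of Chruściel–Costa–Heusler 2012, Thm. 3.1 for the slice
`S := 𝓑.embed(X)` and its closure `S̄` in `M`: (i) `S` is **acausal**; (ii) `S̄` is a **topological `3`-manifold with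
boundary** (homeomorphic to a `C⁰` manifold modelled on the half-space `EuclideanHalfSpace 3`); (iii) `S̄` is the union of
a **compact** set and of the ONE asymptotically flat end of the structure (`S̄ ⊆ C ∪ embed(e.far R')`, `C` compact, some
`R' > R`; the decay is the structure field `isAsymptoticallyFlat`, Chruściel–Costa 2008, §2.1) — "a finite number of
asymptotically-flat ends" specialised to one; (iv) `∂S̄ := S̄ ∖ S ⊆ M ∖ ⟨⟨M_ext⟩⟩` (`doc`); (v) `M` is **globally hyperbolic**
(whence so is the open, causally convex d.o.c. `I⁺(M_ext) ∩ I⁻(M_ext)`; the printed hypothesis asks only the latter —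
clause (v) is stronger, so the named fact below asserts no more than printed).  Spacelikeness and connectedness of `S` and
completeness of the Killing field are structure fields.  The boundaryless predicate `IsSliceRegular` is the case `S̄ = S`.
[cite: ChruscielCostaHeusler2012, Thm. 3.1 (hypotheses)] -/
def IsBoundedSliceRegular (𝓑 : StationaryAFBlackHole.{u}) : Prop :=
  (∀ p ∈ Set.range 𝓑.embed, ∀ q ∈ Set.range 𝓑.embed,
      q ∈ 𝓑.metric.causalFuture 𝓑.timeOrientation {p} → q = p) ∧
    (∃ (Y : Type u) (_ : TopologicalSpace Y) (_ : ChartedSpace (EuclideanHalfSpace 3) Y),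
      Nonempty (Y ≃ₜ closure (Set.range 𝓑.embed))) ∧
    (∃ R' : ℝ, 𝓑.e.R < R' ∧ ∃ C : Set 𝓑.carrier, IsCompact C ∧
      closure (Set.range 𝓑.embed) ⊆ C ∪ 𝓑.embed '' 𝓑.e.far R') ∧
    closure (Set.range 𝓑.embed) \ Set.range 𝓑.embed ⊆ (𝓑.doc)ᶜ ∧
    𝓑.metric.IsGloballyHyperbolic 𝓑.timeOrientation

variable {𝓑} in
/-- Clause (i): the embedded slice is acausal. [cite: ChruscielCostaHeusler2012, Thm. 3.1 (hypotheses)] -/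
lemma IsBoundedSliceRegular.acausal (h : 𝓑.IsBoundedSliceRegular) {p q : 𝓑.carrier}
    (hp : p ∈ Set.range 𝓑.embed) (hq : q ∈ Set.range 𝓑.embed)
    (hpq : q ∈ 𝓑.metric.causalFuture 𝓑.timeOrientation {p}) : q = p :=
  h.1 p hp q hq hpq

variable {𝓑} in
/-- Clause (iv): the boundary `∂S̄ = S̄ ∖ S` of the slice misses the domain of outer communications.
[cite: ChruscielCostaHeusler2012, Thm. 3.1 (hypotheses)] -/
lemma IsBoundedSliceRegular.frontier_subset_compl_doc (h : 𝓑.IsBoundedSliceRegular) :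
    closure (Set.range 𝓑.embed) \ Set.range 𝓑.embed ⊆ (𝓑.doc)ᶜ :=
  h.2.2.2.1

variable {𝓑} in
/-- Clause (v): `M` is globally hyperbolic. [cite: ChruscielCostaHeusler2012, Thm. 3.1 (hypotheses)] -/
lemma IsBoundedSliceRegular.isGloballyHyperbolic (h : 𝓑.IsBoundedSliceRegular) :
    𝓑.metric.IsGloballyHyperbolic 𝓑.timeOrientation :=
  h.2.2.2.2

end StationaryAFBlackHole

/-- **Uniqueness of static vacuum black holes, slices with boundary allowed** (named fact, D-0014): the static
uniqueness schema at the boundary-allowing predicate `StationaryAFBlackHole.IsBoundedSliceRegular`.  Explicitly: let `𝓑` be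
a four-dimensional stationary asymptotically flat black-hole space-time (`StationaryAFBlackHole`: complete stationary Killing
field, timelike on `M_ext`; connected spacelike embedded slice `S = 𝓑.embed(X)` with one asymptotically flat end), such that
`S` is acausal, its closure `S̄ ⊆ M` is a topological `3`-manifold with boundary which is the union of a compact set and of the
asymptotically flat end, `∂S̄ = S̄ ∖ S ⊆ M ∖ ⟨⟨M_ext⟩⟩`, and `M` is globally hyperbolic; suppose the Killing field is
hypersurface-orthogonal on `M` (static) and `Ric(g) = 0` (vacuum; smooth, NOT assumed analytic; no hypothesis on degeneracy
or connectedness of the horizon).  If the future event horizon `𝓔⁺` is non-empty, then `⟨⟨M_ext⟩⟩` is isometric to the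
Schwarzschild exterior `{r > 2M}` for some `M > 0`.  This is the vacuum case of the printed Theorem 3.1 — "Let `(M, g)` be an
electrovacuum, four-dimensional spacetime containing a spacelike, connected, acausal hypersurface `S`, such that `S̄` is a
topological manifold with boundary consisting of the union of a compact set and of a finite number of asymptotically-flat
ends. Suppose that there exists on `M` a complete hypersurface-orthogonal Killing vector, that the domain of outer
communication `⟨⟨M_ext⟩⟩` is globally hyperbolic, and that `∂S̄ ⊂ M ∖ ⟨⟨M_ext⟩⟩`. Then `⟨⟨M_ext⟩⟩` is isometric to the domain of
outer communications of a Reissner–Nordström or a Majumdar–Papapetrou spacetime" — with ONE end and `M` (not only the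
d.o.c.) globally hyperbolic (both only ADD hypotheses), read in vacuum as in `ChruscielGalloway2010_staticUniqueness` (a
Ricci-flat member of those families is Schwarzschild, of positive mass as soon as there is a horizon; analyticity removed by
Chruściel–Galloway 2010, Thm. 1.1 / Thm. 4.1; non-degeneracy not assumed, Chruściel–Reall–Tod 2006).  Unlike
`IsSliceRegular`, this predicate is met by the collar models `{r > ρ} × ℝ` with `S̄ = {x⁰ = 0, r ≥ ρ′}`, `ρ < ρ′ ≤ 2M`.
Hypothesis form: `ChruscielCostaHeusler2012_staticUniquenessWithBoundary.apply`.
[cite: ChruscielCostaHeusler2012, Thm. 3.1 (vacuum case); analyticity removed by ChruscielGalloway2010 Thm. 1.1, Thm. 4.1] -/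
def ChruscielCostaHeusler2012_staticUniquenessWithBoundary : Prop :=
  static_black_hole_uniqueness.{u} StationaryAFBlackHole.IsBoundedSliceRegular

/-- **Static uniqueness with boundary, hypothesis form.** [cite: ChruscielCostaHeusler2012, Thm. 3.1 (vacuum case)] -/
theorem ChruscielCostaHeusler2012_staticUniquenessWithBoundary.apply
    (h : ChruscielCostaHeusler2012_staticUniquenessWithBoundary.{u}) (𝓑 : StationaryAFBlackHole.{u})
    [𝓑.metric.HasLeviCivita] [Kerr.Facts]
    (hF : 𝓑.metric.isOpen_chronologicalFuture 𝓑.timeOrientation)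
    (hP : 𝓑.metric.isOpen_chronologicalPast 𝓑.timeOrientation)
    (hres : PseudoRiemannianMetric.contMDiff_restrict (I := 𝓡 4) (n := ∞) (M := 𝓑.carrier))
    (hreg : 𝓑.IsBoundedSliceRegular) (hstat : 𝓑.IsStatic) (hvac : 𝓑.metric.toPseudoRiemannianMetric.IsRicciFlat)
    (hne : 𝓑.horizon.Nonempty) :
    𝓑.IsIsometricToSchwarzschildExterior hF hP hres :=
  h 𝓑 hF hP hres hreg hstat hvac hne

/-- The boundary-allowing named fact also yields the Kerr-type (gr.S23 ∕ AIK-schema) conclusion at the predicate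
"bounded-slice-regular, static, non-empty horizon". [cite: ChruscielCostaHeusler2012, §3.3.1] -/
theorem ChruscielCostaHeusler2012_staticUniquenessWithBoundary.alexakisIonescuKlainermanRigidity
    (h : ChruscielCostaHeusler2012_staticUniquenessWithBoundary.{u}) :
    AlexakisIonescuKlainermanRigidity.{u} fun 𝓑 ↦
      𝓑.IsBoundedSliceRegular ∧ (∀ [𝓑.metric.HasLeviCivita], 𝓑.IsStatic) ∧ 𝓑.horizon.Nonempty :=
  static_black_hole_uniqueness.alexakisIonescuKlainermanRigidity h

end Literature.Geometry.Lorentzian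

end
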